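import Literature.MathematicalPhysics.QuantumFieldTheory.Balaban1983to89.B9PerturbationMajorantsAtLetters
import Literature.MathematicalPhysics.QuantumFieldTheory.Balaban1983to89.Node00.OpsYGpUnits

/-!
# `Balaban1983to89.B9PerturbationMajorantsAtLettersPhys` — [B9] (3.131) AT THE PRINT-UNITS SITE PROPAGATOR `GpPhysY = etaS² • GpY` (node00-def-Y FILE 28):
# the four Δ′_π split-letter models factor through the letter models WITHOUT the units factor, and the four majorants `hta htb htaR htbR` follow with a
# MEMBER-UNIFORM constant

T. Bałaban, *Propagators for lattice gauge theories in a background field*, Commun. Math. Phys. **99** (1985) 389–434 [`Balaban1985BackgroundPropagators`,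
"B9"]; [4] = T. Bałaban, *Propagators and renormalization transformations for lattice gauge theories. II*, Commun. Math. Phys. **96** (1984) 223–250
[`Balaban1984PropagatorsII`].  statement-level skeleton of published theorems with citation tags; proofs where landed; nothing here is a claim about
the Yang–Mills mass gap.

THE POINT (sequel of `B9PerturbationMajorantsAtLetters`, whose §2 displays `TaLcoK … Gp = etaS⁻² • (BcoKH ∘ GcoS … Gp ∘ RcoK … ∘ DvscoKH)` at ANY `Gp` —
LOCATED-UNITS-D1).  node00-def-Y's `Node00.OpsYGpUnits` (p584417) supplies the print-units site propagator `GpPhysY i parS := (etaS² : ℂ) • GpY i parS`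
(G′ = (η⁻²Δ′_{a,latt})⁻¹, (3.24)–(3.25)) with `RY_GpPhysY : RY … (GpPhysY …) = RY … (GpY …)` (R is degree-0 homogeneous), the consumer recipe being: the
Sect.-D pins of the certificate take `Gp := GpPhysY`.  AT THAT LETTER the units factors cancel exactly:
* §1 `gcoS_GpPhysY : GcoS … (GpPhysY i parS) U₁ = etaS² • GcoS … (GpY i parS) U₁`, `rcoK_GpPhysY`, `pcoK_GpPhysY` (R, P unchanged);
* §2 ★ `taLcoK_phys_eq_comp : TaLcoK … (GpPhysY i parS) U₁ = BcoKH ∘ GcoS … (GpY i parS) U₁ ∘ RcoK … (GpY i parS) U₁ ∘ DvscoKH`, `taRcoK_phys_eq_comp`,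
  `tbLcoKH_phys_eq_comp`, `tbRcoKH_phys_eq_comp` — the split letters at the REPAIRED pin are the plain words in the physical current models and the knit's
  OWN site model `GcoS … (GpY …)` (the one its (3.42) readings are about);
* §3 ★★ `hta_of_letters_phys ∕ htb_of_letters_phys ∕ htaR_of_letters_phys ∕ htbR_of_letters_phys` — the four displayed majorant shapes for the models at
  `GpPhysY`, from `Thm31GpMaj` at `GcoS … (GpY …)`, `Proj349Maj` at `PcoK … (GpY …)`, `CurrentMaj` at `BcoKH ∕ BdcoKH`, with the member-UNIFORM constant
  `t = const3131 (cR39 b)⁻¹ B₀ C_P c L · t_J` (T_a, T_a′) resp. `2·const3131·… · t_J` (T_b, T_b′).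
HONEST SCOPE.  Finite-dimensional bookkeeping; Theorem 3.1, (3.49), (3.117)∕(3.36) remain HYPOTHESIS SCHEMAS; the Δ⁽²⁾ letters and the Hölder pair are not
treated; count-neutral; N06 NOT discharged; nothing continuum ∕ ℝ⁴ ∕ OS ∕ mass gap ∕ Clay.  Cell `pub-ymgap` (HUMAN RULING D-0062), Track A node N06
[B9], bundle F7 rows 20–21, seat `pub-ymgap-dag-n06-l` (g14), 2026-08-27.  NEW file; imports def-Y's FILE 28 BY NAME; nothing landed is modified.
-/

namespace Literature.MathematicalPhysics.QuantumFieldTheory.Balaban1983to89.B9PerturbationMajorantsAtLettersPhys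

open Node00 Node00.OpsYSectDCoords B9Thm312Whole B9Thm312WholeClasses
open B9PerturbationSplitAtLetters B9PerturbationMajorantAlgebra B9PerturbationMajorantLetters B9PerturbationMajorantsAtLetters
open B6KLevelCensusIndexV1 (KIdx)
open B9CoReadingCoords B9CoReadingCoordsH B9CoReadingCoordsS
open B9Thm39ReadingCoords (cR39)
open B11SectG (BlockNorm HasMaj RowSum)
open B9Thm34Ext (toB6)
open B9RWSums343to347Whole (Facts347)
open B9Ineq349SiteComposite (etaS_pos)

noncomputable section

/-! ## §1 The letter models at `GpPhysY`: the site model carries `etaS²`, R and P are unchanged -/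

section Models

variable {𝔸 : Type} [NormedRing 𝔸] [NormedAlgebra ℂ 𝔸] [CompleteSpace 𝔸] [FiniteDimensional ℝ 𝔸]
variable {κ : Type} [Fintype κ]
variable {d ℓ : ℕ} {hd : 1 ≤ d + 1} {hL : Odd (ℓ + 1) ∧ 1 < ℓ + 1} {b₀ b₁ : ℝ} (i : KIdx d ℓ hd hL b₀ b₁)
  (b : Module.Basis κ ℝ 𝔸) (B : B9.Backgrounds) (cfg : B.Cfg → CfgY 𝔸 i) (parS : SiteParY 𝔸 i)

omit [CompleteSpace 𝔸] [FiniteDimensional ℝ 𝔸] in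
/-- `restrictScalars` of a real multiple written as a complex scalar. [cite: Balaban1985BackgroundPropagators, (3.25) p.394, dictionary] -/
private theorem rS_real_smul {T₁ T₂ : Type} (r : ℝ) (f : (T₁ → 𝔸) →ₗ[ℂ] (T₂ → 𝔸)) :
    ((r : ℂ) • f).restrictScalars ℝ = r • f.restrictScalars ℝ := by
  ext x t
  simp only [LinearMap.restrictScalars_apply, LinearMap.smul_apply, Pi.smul_apply, Complex.coe_smul]

/-- the knit's site model at the print-units letter is `etaS²` × the model at the lattice letter. [cite: Balaban1985BackgroundPropagators, (3.25) p.394, (3.42) p.397; Balaban1984PropagatorsII, (2.67) p.234] -/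
theorem gcoS_GpPhysY (U₁ : B.Cfg) : GcoS i b B cfg (GpPhysY i parS) U₁ = (etaS i ^ 2) • GcoS i b B cfg (GpY i parS) U₁ := by
  rw [GcoS, GcoS, GpPhysY_apply, rS_real_smul, coordOpK_smul, smul_smul, smul_smul, mul_comm]

/-- R(U) is the same at both letters (def-Y `RY_GpPhysY`), hence so is its model. [cite: Balaban1985BackgroundPropagators, (3.25) p.394] -/
theorem rcoK_GpPhysY (U₁ : B.Cfg) : RcoK i b B cfg parS (GpPhysY i parS) U₁ = RcoK i b B cfg parS (GpY i parS) U₁ := by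
  rw [RcoK, RcoK, RY_GpPhysY]

omit [FiniteDimensional ℝ 𝔸] in
/-- P(U) = I − R(U) is the same at both letters, hence so is its model. [cite: Balaban1985BackgroundPropagators, (3.21) p.394, (3.49) p.399] -/
theorem pcoK_GpPhysY (U₁ : B.Cfg) : PcoK i b B cfg parS (GpPhysY i parS) U₁ = PcoK i b B cfg parS (GpY i parS) U₁ := by
  rw [PcoK, PcoK, P349Y, P349Y, RY_GpPhysY]

/-! ## §2 The split-letter models at `GpPhysY`: plain words, no units factor -/

/-- ★ **T_a AT THE REPAIRED PIN**: `TaLcoK … (GpPhysY) = BcoKH ∘ GcoS … (GpY) ∘ RcoK … (GpY) ∘ DvscoKH`.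
[cite: Balaban1985BackgroundPropagators, (3.120)–(3.121) pp.419–420, (3.131) p.422, (3.25) p.394] -/
theorem taLcoK_phys_eq_comp (hc : cR39 b ≠ 0) (U₁ : B.Cfg) :
    TaLcoK i b B cfg parS (GpPhysY i parS) U₁ =
      BcoKH i b B cfg U₁ ∘ₗ GcoS i b B cfg (GpY i parS) U₁ ∘ₗ RcoK i b B cfg parS (GpY i parS) U₁ ∘ₗ DvscoKH i b B cfg U₁ := by
  have hη : etaS i ^ 2 ≠ 0 := pow_ne_zero 2 (etaS_pos i).ne'
  rw [taLcoK_eq_comp i b B cfg parS _ hc, gcoS_GpPhysY, rcoK_GpPhysY]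
  simp only [LinearMap.comp_smul, LinearMap.smul_comp, smul_smul, inv_mul_cancel₀ hη, one_smul]

/-- ★ **T_a′ AT THE REPAIRED PIN**: `TaRcoK … (GpPhysY) = DvcoKH ∘ RcoK … (GpY) ∘ GcoS … (GpY) ∘ BdcoKH`.
[cite: Balaban1985BackgroundPropagators, (3.120)–(3.121) pp.419–420, (3.131) p.422, (3.25) p.394] -/
theorem taRcoK_phys_eq_comp (hc : cR39 b ≠ 0) (U₁ : B.Cfg) :
    TaRcoK i b B cfg parS (GpPhysY i parS) U₁ =
      DvcoKH i b B cfg U₁ ∘ₗ RcoK i b B cfg parS (GpY i parS) U₁ ∘ₗ GcoS i b B cfg (GpY i parS) U₁ ∘ₗ BdcoKH i b B cfg U₁ := by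
  have hη : etaS i ^ 2 ≠ 0 := pow_ne_zero 2 (etaS_pos i).ne'
  rw [taRcoK_eq_comp i b B cfg parS _ hc, gcoS_GpPhysY, rcoK_GpPhysY]
  simp only [LinearMap.comp_smul, LinearMap.smul_comp, smul_smul, inv_mul_cancel₀ hη, one_smul]

/-- ★ **T_b AT THE REPAIRED PIN**: `TbLcoKH … (GpPhysY) = RcoK∘GcoS∘BdcoKH − RcoK∘GcoS∘DvscoKH∘BcoKH∘GcoS∘RcoK∘DvscoKH` (all at `GpY`).
[cite: Balaban1985BackgroundPropagators, (3.120)–(3.121) pp.419–420, (3.131) p.422, (3.25) p.394] -/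
theorem tbLcoKH_phys_eq_comp (hc : cR39 b ≠ 0) (U₁ : B.Cfg) :
    TbLcoKH i b B cfg parS (GpPhysY i parS) U₁ =
      RcoK i b B cfg parS (GpY i parS) U₁ ∘ₗ GcoS i b B cfg (GpY i parS) U₁ ∘ₗ BdcoKH i b B cfg U₁ -
      RcoK i b B cfg parS (GpY i parS) U₁ ∘ₗ GcoS i b B cfg (GpY i parS) U₁ ∘ₗ DvscoKH i b B cfg U₁ ∘ₗ BcoKH i b B cfg U₁ ∘ₗ
        GcoS i b B cfg (GpY i parS) U₁ ∘ₗ RcoK i b B cfg parS (GpY i parS) U₁ ∘ₗ DvscoKH i b B cfg U₁ := by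
  have hη : etaS i ^ 2 ≠ 0 := pow_ne_zero 2 (etaS_pos i).ne'
  have hη1 : etaS i ≠ 0 := (etaS_pos i).ne'
  rw [tbLcoKH_eq_comp i b B cfg parS _ hc, gcoS_GpPhysY, rcoK_GpPhysY]
  simp only [LinearMap.comp_smul, LinearMap.smul_comp, smul_smul]
  rw [inv_mul_cancel₀ hη, one_smul, show (etaS i ^ 2)⁻¹ ^ 2 * (etaS i ^ 2 * etaS i ^ 2) = 1 by field_simp, one_smul]

/-- ★ **T_b′ AT THE REPAIRED PIN**: `TbRcoKH … (GpPhysY) = BcoKH∘GcoS∘RcoK − DvcoKH∘RcoK∘GcoS∘BdcoKH∘DvcoKH∘GcoS∘RcoK` (all at `GpY`).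
[cite: Balaban1985BackgroundPropagators, (3.120)–(3.121) pp.419–420, (3.131) p.422, (3.25) p.394] -/
theorem tbRcoKH_phys_eq_comp (hc : cR39 b ≠ 0) (U₁ : B.Cfg) :
    TbRcoKH i b B cfg parS (GpPhysY i parS) U₁ =
      BcoKH i b B cfg U₁ ∘ₗ GcoS i b B cfg (GpY i parS) U₁ ∘ₗ RcoK i b B cfg parS (GpY i parS) U₁ -
      DvcoKH i b B cfg U₁ ∘ₗ RcoK i b B cfg parS (GpY i parS) U₁ ∘ₗ GcoS i b B cfg (GpY i parS) U₁ ∘ₗ BdcoKH i b B cfg U₁ ∘ₗ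
        DvcoKH i b B cfg U₁ ∘ₗ GcoS i b B cfg (GpY i parS) U₁ ∘ₗ RcoK i b B cfg parS (GpY i parS) U₁ := by
  have hη : etaS i ^ 2 ≠ 0 := pow_ne_zero 2 (etaS_pos i).ne'
  have hη1 : etaS i ≠ 0 := (etaS_pos i).ne'
  rw [tbRcoKH_eq_comp i b B cfg parS _ hc, gcoS_GpPhysY, rcoK_GpPhysY]
  simp only [LinearMap.comp_smul, LinearMap.smul_comp, smul_smul]
  rw [inv_mul_cancel₀ hη, one_smul, show (etaS i ^ 2)⁻¹ ^ 2 * (etaS i ^ 2 * etaS i ^ 2) = 1 by field_simp, one_smul]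

end Models

/-! ## §3 The four displayed Δ′_π majorants at the repaired pin, member-uniform constants -/

section Majorants

variable {𝔸 : Type} [NormedRing 𝔸] [NormedAlgebra ℂ 𝔸] [CompleteSpace 𝔸] [FiniteDimensional ℝ 𝔸]
variable {κ : Type} [Fintype κ]
variable {d ℓ : ℕ} {hd : 1 ≤ d + 1} {hL : Odd (ℓ + 1) ∧ 1 < ℓ + 1} {b₀ b₁ : ℝ}
variable {g : B9.Geometry} [Fintype g.Site] {R₀ : ℝ} {H₀ : Prop}
variable {i : KIdx d ℓ hd hL b₀ b₁} {b : Module.Basis κ ℝ 𝔸} {B : B9.Backgrounds} {cfg : B.Cfg → CfgY 𝔸 i}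
  {parS : SiteParY 𝔸 i} {U₁ : B.Cfg} {blkW : XSK κ i → g.Site} {blk : XBK κ i → g.Site}
  {B₀ δ₀ CP δP tJ θ δB r δT σ c : ℝ} {dF : ℕ} {δ α L₀ : ℝ}

/-- ★★ **`hta` AT THE REPAIRED PIN, UNIFORM CONSTANT**: the displayed majorant of `TaLcoK … (GpPhysY i parS) U₁` between `cNorm … 2 → cNorm … 0`, kernel
`t·θ·e^{−δ_T d}` with t = const3131·t_J (no etaS), from the three schemas at the knit's letter models (`GcoS … (GpY …)`, `PcoK … (GpY …)`, `BcoKH ∕ BdcoKH`).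
[cite: Balaban1985BackgroundPropagators, (3.130)–(3.131) pp.421–422, (3.42) p.397, (3.49) p.399, (3.117) p.419, (3.36) p.396; Balaban1984PropagatorsII, (2.54), (2.60)–(2.61) pp.233–234] -/
theorem hta_of_letters_phys (hG : GeoOK g) (hF : Facts347 g R₀ H₀ dF δ α L₀) (hrow : RowSum (toB6 g R₀ H₀) σ c) (hc0 : 0 < cR39 b)
    (h31 : Thm31GpMaj blkW blk (GcoS i b B cfg (GpY i parS) U₁) (DvcoKH i b B cfg U₁) (DvscoKH i b B cfg U₁) R₀ H₀ B₀ δ₀)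
    (h49 : Proj349Maj blkW blk (PcoK i b B cfg parS (GpY i parS) U₁) (DvcoKH i b B cfg U₁) (DvscoKH i b B cfg U₁) R₀ H₀ CP δP)
    (hB : CurrentMaj blkW blk (BcoKH i b B cfg U₁) (BdcoKH i b B cfg U₁) R₀ H₀ (tJ * θ) δB)
    (hB₀ : 0 ≤ B₀) (hCP : 0 ≤ CP) (htJ : 0 ≤ tJ) (hθ : 0 ≤ θ) (hc : 0 ≤ c) (hσ : 0 ≤ σ) (hτ : 0 ≤ α * δ)
    (hr₀ : r ≤ δ₀) (hrP : r ≤ δP) (hrB : r ≤ δB) (hδT₀ : 0 ≤ δT) (hδT : δT + 2 * σ + 3 * (α * δ) ≤ r) :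
    HasMaj (cNorm R₀ H₀ blk hG.lenle 2) (cNorm R₀ H₀ blk hG.lenle 0) (TaLcoK i b B cfg parS (GpPhysY i parS) U₁)
      (fun a a' => const3131 (cR39 b)⁻¹ B₀ CP c g.L * tJ * θ * Real.exp (-(δT * g.dist a a'))) := by
  rw [taLcoK_phys_eq_comp i b B cfg parS hc0.ne']
  have h := maj_taL hG hF hrow h31 h49 hB (rcoK_eq i b B cfg parS (GpY i parS) U₁) (inv_nonneg.mpr hc0.le) hB₀ hCP (mul_nonneg htJ hθ)
    hc hσ hτ hr₀ hrP hrB hδT₀ hδT 1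
  rw [one_smul] at h
  refine h.mono fun a a' => le_of_eq ?_
  show |(1 : ℝ)| * (const3131 (cR39 b)⁻¹ B₀ CP c g.L * (tJ * θ)) * Real.exp (-(δT * g.dist a a')) = _
  rw [abs_one]
  ring

/-- ★★ **`htb` AT THE REPAIRED PIN, UNIFORM CONSTANT**: the displayed majorant of `TbLcoKH … (GpPhysY i parS) U₁` between `cNorm … blk 2 → cNorm … blkW 1`,
t = 2·const3131·t_J. [cite: Balaban1985BackgroundPropagators, (3.130)–(3.131) pp.421–422, (3.42) p.397, (3.49) p.399, (3.117) p.419, (3.36) p.396; Balaban1984PropagatorsII, (2.54), (2.60)–(2.61) pp.233–234] -/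
theorem htb_of_letters_phys (hG : GeoOK g) (hF : Facts347 g R₀ H₀ dF δ α L₀) (hrow : RowSum (toB6 g R₀ H₀) σ c) (hc0 : 0 < cR39 b)
    (h31 : Thm31GpMaj blkW blk (GcoS i b B cfg (GpY i parS) U₁) (DvcoKH i b B cfg U₁) (DvscoKH i b B cfg U₁) R₀ H₀ B₀ δ₀)
    (h49 : Proj349Maj blkW blk (PcoK i b B cfg parS (GpY i parS) U₁) (DvcoKH i b B cfg U₁) (DvscoKH i b B cfg U₁) R₀ H₀ CP δP)
    (hB : CurrentMaj blkW blk (BcoKH i b B cfg U₁) (BdcoKH i b B cfg U₁) R₀ H₀ (tJ * θ) δB)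
    (hB₀ : 0 ≤ B₀) (hCP : 0 ≤ CP) (htJ : 0 ≤ tJ) (hθ : 0 ≤ θ) (hc : 0 ≤ c) (hσ : 0 ≤ σ) (hτ : 0 ≤ α * δ)
    (hr₀ : r ≤ δ₀) (hrP : r ≤ δP) (hrB : r ≤ δB) (hδT₀ : 0 ≤ δT) (hδT : δT + 2 * σ + 3 * (α * δ) ≤ r) :
    HasMaj (cNorm R₀ H₀ blk hG.lenle 2) (cNorm R₀ H₀ blkW hG.lenle 1) (TbLcoKH i b B cfg parS (GpPhysY i parS) U₁)
      (fun a a' => 2 * const3131 (cR39 b)⁻¹ B₀ CP c g.L * tJ * θ * Real.exp (-(δT * g.dist a a'))) := by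
  rw [tbLcoKH_phys_eq_comp i b B cfg parS hc0.ne']
  have h := maj_tbL hG hF hrow h31 h49 hB (rcoK_eq i b B cfg parS (GpY i parS) U₁) (inv_nonneg.mpr hc0.le) hB₀ hCP (mul_nonneg htJ hθ)
    hc hσ hτ hr₀ hrP hrB hδT₀ hδT 1 1
  rw [one_smul, one_smul] at h
  refine h.mono fun a a' => le_of_eq ?_
  show (|(1 : ℝ)| + |(1 : ℝ)|) * (const3131 (cR39 b)⁻¹ B₀ CP c g.L * (tJ * θ)) * Real.exp (-(δT * g.dist a a')) = _
  rw [abs_one]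
  ring

/-- ★★ **`htaR` AT THE REPAIRED PIN, UNIFORM CONSTANT**: the displayed majorant of `TaRcoK … (GpPhysY i parS) U₁`, t = const3131·t_J.
[cite: Balaban1985BackgroundPropagators, (3.130)–(3.131) pp.421–422, (3.42) p.397, (3.49) p.399, (3.117) p.419; Balaban1984PropagatorsII, (2.26) p.228, (2.54), (2.60)–(2.61) pp.233–234] -/
theorem htaR_of_letters_phys (hG : GeoOK g) (hF : Facts347 g R₀ H₀ dF δ α L₀) (hrow : RowSum (toB6 g R₀ H₀) σ c) (hc0 : 0 < cR39 b)
    (h31 : Thm31GpMaj blkW blk (GcoS i b B cfg (GpY i parS) U₁) (DvcoKH i b B cfg U₁) (DvscoKH i b B cfg U₁) R₀ H₀ B₀ δ₀)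
    (h49 : Proj349Maj blkW blk (PcoK i b B cfg parS (GpY i parS) U₁) (DvcoKH i b B cfg U₁) (DvscoKH i b B cfg U₁) R₀ H₀ CP δP)
    (hB : CurrentMaj blkW blk (BcoKH i b B cfg U₁) (BdcoKH i b B cfg U₁) R₀ H₀ (tJ * θ) δB)
    (hB₀ : 0 ≤ B₀) (hCP : 0 ≤ CP) (htJ : 0 ≤ tJ) (hθ : 0 ≤ θ) (hc : 0 ≤ c) (hσ : 0 ≤ σ) (hτ : 0 ≤ α * δ)
    (hr₀ : r ≤ δ₀) (hrP : r ≤ δP) (hrB : r ≤ δB) (hδT₀ : 0 ≤ δT) (hδT : δT + 2 * σ + 3 * (α * δ) ≤ r) :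
    HasMaj (cNorm R₀ H₀ blk hG.lenle 2) (cNorm R₀ H₀ blk hG.lenle 0) (TaRcoK i b B cfg parS (GpPhysY i parS) U₁)
      (fun a a' => const3131 (cR39 b)⁻¹ B₀ CP c g.L * tJ * θ * Real.exp (-(δT * g.dist a a'))) := by
  rw [taRcoK_phys_eq_comp i b B cfg parS hc0.ne']
  have h := maj_taR hG hF hrow h31 h49 hB (rcoK_eq i b B cfg parS (GpY i parS) U₁) (inv_nonneg.mpr hc0.le) hB₀ hCP (mul_nonneg htJ hθ)
    hc hσ hτ hr₀ hrP hrB hδT₀ hδT 1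
  rw [one_smul] at h
  refine h.mono fun a a' => le_of_eq ?_
  show |(1 : ℝ)| * (const3131 (cR39 b)⁻¹ B₀ CP c g.L * (tJ * θ)) * Real.exp (-(δT * g.dist a a')) = _
  rw [abs_one]
  ring

/-- ★★ **`htbR` AT THE REPAIRED PIN, UNIFORM CONSTANT**: the displayed majorant of `TbRcoKH … (GpPhysY i parS) U₁` between `cNormR … blkW 0 → cNormR … blk 1`,
t = 2·const3131·t_J. [cite: Balaban1985BackgroundPropagators, (3.130)–(3.131) pp.421–422, (3.42) p.397, (3.49) p.399, (3.117) p.419; Balaban1984PropagatorsII, (2.26) p.228, (2.54), (2.60)–(2.61) pp.233–234] -/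
theorem htbR_of_letters_phys (hG : GeoOK g) (hF : Facts347 g R₀ H₀ dF δ α L₀) (hrow : RowSum (toB6 g R₀ H₀) σ c) (hc0 : 0 < cR39 b)
    (h31 : Thm31GpMaj blkW blk (GcoS i b B cfg (GpY i parS) U₁) (DvcoKH i b B cfg U₁) (DvscoKH i b B cfg U₁) R₀ H₀ B₀ δ₀)
    (h49 : Proj349Maj blkW blk (PcoK i b B cfg parS (GpY i parS) U₁) (DvcoKH i b B cfg U₁) (DvscoKH i b B cfg U₁) R₀ H₀ CP δP)
    (hB : CurrentMaj blkW blk (BcoKH i b B cfg U₁) (BdcoKH i b B cfg U₁) R₀ H₀ (tJ * θ) δB)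
    (hB₀ : 0 ≤ B₀) (hCP : 0 ≤ CP) (htJ : 0 ≤ tJ) (hθ : 0 ≤ θ) (hc : 0 ≤ c) (hσ : 0 ≤ σ) (hτ : 0 ≤ α * δ)
    (hr₀ : r ≤ δ₀) (hrP : r ≤ δP) (hrB : r ≤ δB) (hδT₀ : 0 ≤ δT) (hδT : δT + 2 * σ + 3 * (α * δ) ≤ r) :
    HasMaj (cNormR R₀ H₀ blkW hG.lenle 0) (cNormR R₀ H₀ blk hG.lenle 1) (TbRcoKH i b B cfg parS (GpPhysY i parS) U₁)
      (fun a a' => 2 * const3131 (cR39 b)⁻¹ B₀ CP c g.L * tJ * θ * Real.exp (-(δT * g.dist a a'))) := by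
  rw [tbRcoKH_phys_eq_comp i b B cfg parS hc0.ne']
  have h := maj_tbR hG hF hrow h31 h49 hB (rcoK_eq i b B cfg parS (GpY i parS) U₁) (inv_nonneg.mpr hc0.le) hB₀ hCP (mul_nonneg htJ hθ)
    hc hσ hτ hr₀ hrP hrB hδT₀ hδT 1 1
  rw [one_smul, one_smul] at h
  refine h.mono fun a a' => le_of_eq ?_
  show (|(1 : ℝ)| + |(1 : ℝ)|) * (const3131 (cR39 b)⁻¹ B₀ CP c g.L * (tJ * θ)) * Real.exp (-(δT * g.dist a a')) = _
  rw [abs_one]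
  ring

end Majorants

end

end Literature.MathematicalPhysics.QuantumFieldTheory.Balaban1983to89.B9PerturbationMajorantsAtLettersPhys
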